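import Mathlib
import Summits.MatrixMultiplication.MatrixMultiplication.Theorems.FidelityWitnessesFidelityGapThreeSeventeenStubFatBorderApolarityForms
import Summits.MatrixMultiplication.MatrixMultiplication.Theorems.FidelityWitnessesFidelityGapThreeSeventeenPunctualDefs

/-!
# Borel-fixed border apolarity at `(⟨3,3,3⟩, 17)` — part 6: transport of Slip witnesses under
# invertible slot-preserving linear substitutions

Crux `stmt-MatrixMultiplication-4958` (`FidelityWitnesses.FidelityGapThreeSeventeen`), line
`punctual-saturation`, stub `stub_borelFixedApolarity` (helper file for the Borel normal form half).

A matrix `a : Var → Var → ℂ` acts on points of `C ⊕ A ⊕ B` by `x ↦ (v ↦ ∑_{v'} a v v' x v')` and on the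
Cox ring `S` by the substitution `φ_a = aeval (v ↦ ∑_{v'} a v v' X_{v'})`, so that `(φ_a f)(x) = f(a x)`
(`Transport.aeval_subst`).  For a SLOT-PRESERVING `a` (`a v v' = 0` unless `v, v'` lie in the same slot)
`φ_a` preserves every piece `S_D` (`Transport.subst_mem_SD`); for an invertible one (two-sided inverse
`b`) `φ_a ∘ φ_b = φ_b ∘ φ_a = id` (`Transport.subst_subst`), the vanishing pieces transform by
`φ_a (I(a Γ)_D) = I(Γ)_D` with equal dimensions (`Transport.map_vanishPiece`,
`Transport.inGeneralPosition_act`), coefficientwise convergence inside a piece is preserved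
(`Transport.coeffTendsto_map`), and hence **Slip witnesses are transported**: if `Γ` witnesses
`I` then `a Γ` witnesses `φ_b I` (`stub_borelFixedApolarity_transport`).  This is the
equivariance input of the diagonal-sequence argument that keeps `IsSlipLimit` along the Borel
degenerations `g(s) · I`, `s → ∞` (Buczyńska–Buczyński 2021 Thm 4.3 / CHL 2023 §2.4 in the line's
sequential language).  Elementary; everything proved.
-/

noncomputable section

namespace Summit.MatrixMultiplication.MatrixMultiplication.Theorems.PunctualSaturation

-- single-conjunct summit: the `Summit.<S>.<P>` prefix repeats `MatrixMultiplication` by design (D-0017)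
set_option linter.dupNamespace false

open scoped BigOperators Topology
open MvPolynomial Module Filter
open Summit.MatrixMultiplication.MatrixMultiplication.Theorems.SymbolicSquare.FatBorder

namespace Transport

variable (a b : Var → Var → ℂ)

/-! ## The substitution of a matrix and its action on points -/

/-- `(φ_a f)(x) = f(a x)`: substituting then evaluating is evaluating at the transformed point.
[folklore] -/
theorem aeval_subst (x : Var → ℂ) (f : S) :
    aeval x (aeval (fun v => ∑ v', C (a v v') * X v') f) = aeval (fun v => ∑ v', a v v' * x v') f := by
  have h := congrArg (fun ψ : S →ₐ[ℂ] ℂ => ψ f)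
    (MvPolynomial.comp_aeval (aeval x : S →ₐ[ℂ] ℂ) (f := fun v => ∑ v', C (a v v') * X v'))
  simpa [map_sum] using h

/-- A slot-preserving substitution sends variables to linear forms of the same weight. [folklore] -/
theorem isWeightedHomogeneous_subst_X (ha : ∀ v v', v.1 ≠ v'.1 → a v v' = 0) (v : Var) :
    IsWeightedHomogeneous wt (∑ v', C (a v v') * X v' : S) (wt v) := by
  refine IsWeightedHomogeneous.sum _ _ _ fun v' _ => ?_
  by_cases h : v.1 = v'.1
  · have hw : wt v = wt v' := by simp [wt, h]
    rw [hw]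
    exact (isWeightedHomogeneous_X ℂ wt v').C_mul _
  · rw [ha v v' h, C_0, zero_mul]
    exact isWeightedHomogeneous_zero ℂ wt _

/-- **A slot-preserving substitution preserves every piece `S_D`.** [folklore] -/
theorem subst_mem_SD (ha : ∀ v v', v.1 ≠ v'.1 → a v v' = 0) {D : Fin 3 → ℕ} {f : S}
    (hf : f ∈ SD D) : aeval (fun v => ∑ v', C (a v v') * X v') f ∈ SD D := by
  classical
  rw [SD, mem_weightedHomogeneousSubmodule] at hf ⊢
  rw [f.as_sum, map_sum]
  refine IsWeightedHomogeneous.sum _ _ _ fun d hd => ?_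
  rw [aeval_monomial, Finsupp.prod]
  have hD : ∑ v ∈ d.support, d v • wt v = D := by
    rw [← hf (mem_support_iff.1 hd), Finsupp.weight_apply, Finsupp.sum]
  rw [← hD]
  exact (IsWeightedHomogeneous.prod _ _ _ fun v _ =>
    (isWeightedHomogeneous_subst_X a ha v).pow (d v)).C_mul _

/-- Substituting `a` into the linear forms of `b` gives the linear forms of `b · a`; for `b · a = 1`
these are the variables. [folklore] -/
theorem aeval_subst_X (hba : ∀ v v'', ∑ v', b v v' * a v' v'' = if v = v'' then 1 else 0) (v : Var) :
    aeval (fun v => ∑ v', C (a v v') * X v') (∑ v', C (b v v') * X v' : S) = X v := by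
  classical
  simp only [map_sum, map_mul, aeval_C, aeval_X, algebraMap_eq]
  simp_rw [Finset.mul_sum]
  rw [Finset.sum_comm]
  have h1 : ∀ v'', ∑ v', C (b v v') * (C (a v' v'') * X v'') = C (∑ v', b v v' * a v' v'') * (X v'' : S) := by
    intro v''
    rw [map_sum, Finset.sum_mul]
    refine Finset.sum_congr rfl fun v' _ => ?_
    rw [map_mul, mul_assoc]
  simp_rw [h1, hba]
  simp_rw [apply_ite C, C_1, C_0, ite_mul, one_mul, zero_mul]
  rw [Finset.sum_ite_eq]
  simp

/-- **Inverse matrices give inverse substitutions**: `φ_a ∘ φ_b = id` when `b · a = 1`. [folklore] -/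
theorem subst_comp (hba : ∀ v v'', ∑ v', b v v' * a v' v'' = if v = v'' then 1 else 0) :
    (aeval (fun v => ∑ v', C (a v v') * X v') : S →ₐ[ℂ] S).comp
      (aeval (fun v => ∑ v', C (b v v') * X v') : S →ₐ[ℂ] S) = AlgHom.id ℂ S := by
  refine MvPolynomial.algHom_ext fun v => ?_
  rw [AlgHom.comp_apply, aeval_X, AlgHom.id_apply]
  exact aeval_subst_X a b hba v

/-- `φ_a (φ_b f) = f` when `b · a = 1`. [folklore] -/
theorem subst_subst (hba : ∀ v v'', ∑ v', b v v' * a v' v'' = if v = v'' then 1 else 0) (f : S) :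
    aeval (fun v => ∑ v', C (a v v') * X v') (aeval (fun v => ∑ v', C (b v v') * X v') f) = f := by
  have h := AlgHom.congr_fun (subst_comp a b hba) f
  rwa [AlgHom.comp_apply, AlgHom.id_apply] at h

/-! ## Vanishing pieces and general position -/

/-- Membership in a vanishing piece. [folklore] -/
theorem mem_vanishPiece_iff (γ : Config) (D : Fin 3 → ℕ) (f : S) :
    f ∈ vanishPiece γ D ↔ (∀ ρ, aeval (γ ρ) f = 0) ∧ f ∈ SD D := by
  simp only [vanishPiece, evalAt, Submodule.mem_inf, LinearMap.mem_ker]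
  constructor
  · rintro ⟨h, hD⟩
    exact ⟨fun ρ => by simpa using congr_fun h ρ, hD⟩
  · rintro ⟨h, hD⟩
    exact ⟨funext fun ρ => by simpa using h ρ, hD⟩

/-- **`φ_a (I(a Γ)_D) = I(Γ)_D`** for an invertible slot-preserving `a`. [folklore] -/
theorem map_vanishPiece (ha : ∀ v v', v.1 ≠ v'.1 → a v v' = 0) (hb : ∀ v v', v.1 ≠ v'.1 → b v v' = 0)
    (hba : ∀ v v'', ∑ v', b v v' * a v' v'' = if v = v'' then 1 else 0) (γ : Config) (D : Fin 3 → ℕ) :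
    (vanishPiece (fun ρ v => ∑ v', a v v' * γ ρ v') D).map
        (aeval (fun v => ∑ v', C (a v v') * X v') : S →ₐ[ℂ] S).toLinearMap =
      vanishPiece γ D := by
  ext g
  rw [Submodule.mem_map]
  constructor
  · rintro ⟨f, hf, rfl⟩
    rw [mem_vanishPiece_iff] at hf ⊢
    refine ⟨fun ρ => ?_, subst_mem_SD a ha hf.2⟩
    rw [AlgHom.toLinearMap_apply, aeval_subst]
    exact hf.1 ρ
  · intro hg
    rw [mem_vanishPiece_iff] at hg
    refine ⟨aeval (fun v => ∑ v', C (b v v') * X v') g, ?_, ?_⟩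
    · rw [mem_vanishPiece_iff]
      refine ⟨fun ρ => ?_, subst_mem_SD b hb hg.2⟩
      rw [← aeval_subst, subst_subst a b hba]
      exact hg.1 ρ
    · rw [AlgHom.toLinearMap_apply, subst_subst a b hba]

/-- `φ_a` is injective when `a` has a left inverse substitution. [folklore] -/
theorem subst_injective (hab : ∀ v v'', ∑ v', a v v' * b v' v'' = if v = v'' then 1 else 0) :
    Function.Injective (aeval (fun v => ∑ v', C (a v v') * X v') : S →ₐ[ℂ] S) := by
  intro f g h
  have := congrArg (aeval (fun v => ∑ v', C (b v v') * X v') : S →ₐ[ℂ] S) h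
  rwa [subst_subst b a hab, subst_subst b a hab] at this

/-- **General position is invariant under invertible slot-preserving substitutions.** [folklore] -/
theorem inGeneralPosition_act (ha : ∀ v v', v.1 ≠ v'.1 → a v v' = 0)
    (hb : ∀ v v', v.1 ≠ v'.1 → b v v' = 0)
    (hab : ∀ v v'', ∑ v', a v v' * b v' v'' = if v = v'' then 1 else 0)
    (hba : ∀ v v'', ∑ v', b v v' * a v' v'' = if v = v'' then 1 else 0) {γ : Config}
    (hγ : InGeneralPosition γ) : InGeneralPosition (fun ρ v => ∑ v', a v v' * γ ρ v') := by
  intro D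
  have h1 : finrank ℂ ↥(vanishPiece (fun ρ v => ∑ v', a v v' * γ ρ v') D) =
      finrank ℂ ↥(vanishPiece γ D) := by
    rw [← map_vanishPiece a b ha hb hba γ D]
    exact LinearEquiv.finrank_eq (Submodule.equivMapOfInjective
      ((aeval (fun v => ∑ v', C (a v v') * X v') : S →ₐ[ℂ] S).toLinearMap)
      (subst_injective a b hab) (vanishPiece (fun ρ v => ∑ v', a v v' * γ ρ v') D))
  rw [h1]
  exact hγ D

/-! ## Coefficientwise convergence inside a piece -/

/-- **A fixed linear map preserves coefficientwise convergence of sequences inside one piece `S_D`**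
(the piece is finite-dimensional, spanned by its monomials). [folklore] -/
theorem coeffTendsto_map (ψ : S →ₗ[ℂ] S) {D : Fin 3 → ℕ} {fseq : ℕ → S} {f : S}
    (hseq : ∀ k, fseq k ∈ SD D) (hf : f ∈ SD D) (h : CoeffTendsto fseq f) :
    CoeffTendsto (fun k => ψ (fseq k)) (ψ f) := by
  have hw : ∀ v : Var, ∑ l, wt v l = 1 := fun v => by simp [wt]
  -- expansion of `ψ g`, `g ∈ S_D`, along the monomials of weight `D`
  have hexp : ∀ g ∈ SD D, ∀ e : Var →₀ ℕ, coeff e (ψ g) =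
      ∑ d : Mon wt D, coeff d.1 g * coeff e (ψ (monomial d.1 1)) := by
    intro g hg e
    conv_lhs => rw [← form_coeff wt D hw hg]
    simp only [form, LinearMap.coe_mk, AddHom.coe_mk, map_sum, coeff_sum]
    refine Finset.sum_congr rfl fun d _ => ?_
    rw [show monomial d.1 (coeff d.1 g) = coeff d.1 g • monomial d.1 (1 : ℂ) by
      rw [smul_monomial, smul_eq_mul, mul_one], map_smul, coeff_smul, smul_eq_mul]
  intro e
  rw [hexp f hf e]
  have : (fun k => coeff e (ψ (fseq k))) =
      fun k => ∑ d : Mon wt D, coeff d.1 (fseq k) * coeff e (ψ (monomial d.1 1)) :=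
    funext fun k => hexp _ (hseq k) e
  rw [this]
  exact tendsto_finsetSum _ fun d _ => (h d.1).mul_const _

/-! ## Transport of Slip witnesses -/

/-- **Slip witnesses are transported by invertible slot-preserving substitutions**: if `Γ` witnesses
`I` then `a Γ` witnesses `φ_b I`. [cite: BuczynskaBuczynski2021, Thm 4.3] -/
theorem isSlipWitness_map (ha : ∀ v v', v.1 ≠ v'.1 → a v v' = 0)
    (hb : ∀ v v', v.1 ≠ v'.1 → b v v' = 0)
    (hab : ∀ v v'', ∑ v', a v v' * b v' v'' = if v = v'' then 1 else 0)
    (hba : ∀ v v'', ∑ v', b v v' * a v' v'' = if v = v'' then 1 else 0) {I : Ideal S}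
    {Γ : ℕ → Config} (hΓ : IsSlipWitness I Γ) :
    IsSlipWitness (I.map (aeval (fun v => ∑ v', C (b v v') * X v') : S →ₐ[ℂ] S))
      (fun k ρ v => ∑ v', a v v' * Γ k ρ v') := by
  set φa : S →ₐ[ℂ] S := aeval (fun v => ∑ v', C (a v v') * X v') with hφa
  set φb : S →ₐ[ℂ] S := aeval (fun v => ∑ v', C (b v v') * X v') with hφb
  have hsurj : Function.Surjective φb := fun g => ⟨φa g, subst_subst b a hab g⟩
  refine ⟨fun k => inGeneralPosition_act a b ha hb hab hba (hΓ.1 k), fun D g hg => ?_⟩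
  -- `g = φ_b f` with `f ∈ I_D`
  have hgI : g ∈ I.map φb := hg.1
  have hgD : g ∈ SD D := hg.2
  rw [Ideal.mem_map_iff_of_surjective φb hsurj] at hgI
  obtain ⟨f, hfI, rfl⟩ := hgI
  have hfD : f ∈ SD D := by
    have := subst_mem_SD a ha hgD
    rwa [subst_subst a b hba] at this
  obtain ⟨fseq, hseq, hlim⟩ := hΓ.2 D f ⟨hfI, hfD⟩
  refine ⟨fun k => φb (fseq k), fun k => ?_, ?_⟩
  · have hk := hseq k
    rw [mem_vanishPiece_iff] at hk ⊢
    refine ⟨fun ρ => ?_, subst_mem_SD b hb hk.2⟩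
    rw [hφb, ← aeval_subst, subst_subst a b hba]
    exact hk.1 ρ
  · exact coeffTendsto_map φb.toLinearMap (fun k => ((mem_vanishPiece_iff _ _ _).1 (hseq k)).2) hfD hlim

end Transport

/-- **Registered sub-goal `stub_borelFixedApolarity_transport` of `stub_borelFixedApolarity`**: Slip
witnesses are transported by invertible slot-preserving linear substitutions of `C ⊕ A ⊕ B` (the
equivariance input of the Borel normal form for Slip limits). [cite: BuczynskaBuczynski2021, Thm 4.3] -/
theorem stub_borelFixedApolarity_transport :
    ∀ (a b : Var → Var → ℂ), (∀ v v', v.1 ≠ v'.1 → a v v' = 0) → (∀ v v', v.1 ≠ v'.1 → b v v' = 0) →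
      (∀ v v'', ∑ v', a v v' * b v' v'' = if v = v'' then 1 else 0) →
      (∀ v v'', ∑ v', b v v' * a v' v'' = if v = v'' then 1 else 0) →
      ∀ (I : Ideal S) (Γ : ℕ → Config), IsSlipWitness I Γ →
        IsSlipWitness (I.map (MvPolynomial.aeval (fun v => ∑ v', MvPolynomial.C (b v v') * MvPolynomial.X v') :
            S →ₐ[ℂ] S))
          (fun k ρ v => ∑ v', a v v' * Γ k ρ v') :=
  fun a b ha hb hab hba _ _ hΓ => Transport.isSlipWitness_map a b ha hb hab hba hΓ

end Summit.MatrixMultiplication.MatrixMultiplication.Theorems.PunctualSaturation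

end
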